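import Mathlib
import Summits.PneNP.PneNP.Theorems.PstarGapAdversary

/-!
# The adversary for a gap FUNCTION (ROUND-24 item T24.7′)

FRONTIER range-avoidance ladder (cell `pnp-ideate`, ROUND-24 gap-lemma programme; restricted-model combinatorics — nothing here bears
on `P` versus `NP`).

`PstarGapAdversary.gapAdversary` (T24.7) turns a LINEAR gap bound `#J ≤ K·#W` on minimal infeasible sets into parity-decision-tree
depth `≥ (r − 1)/(2K)`.  The cell's quotient induction (memo §13 R7) currently proves the XOR-disjoint core only with an EXPONENTIAL gap
function, and a POLYNOMIAL one would already give depth `n^{Ω(1)}`; so the adversary is restated here for an arbitrary monotone gap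
function `g`: `GapBoundFn g r I y := ∀ W J, #J ≤ r → MinInfeasible I y W J → #J ≤ g #W`, and

* `gapAdversaryFn : Monotone g → GapBoundFn g r I y → T.Solves I y → r ≤ 2·g(T.depth) + 1`

— the halving / recovery proof of T24.7 verbatim with `K·#W` replaced by `g #W` (invariant: `⌊r/2⌋ < g(#W + depth T)` for an
`r`-feasible `W` on whose solutions `T` solves the search problem).  `gapBoundFn_of_gapBound` recovers the linear case.
-/

set_option linter.dupNamespace false -- `Summit.PneNP.PneNP.…`: summit = sub-problem name (D-0017 single-conjunct layout)

open Finset Literature.Computability.Complexity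
open Summit.PneNP.PneNP.Theorems.PstarPDT (PDT parity)
open Summit.PneNP.PneNP.Theorems.PstarGapLemma (Sat Feasible MinInfeasible RFeasible GapBound)
open Summit.PneNP.PneNP.Theorems.PstarGapAdversary (solvesOn_empty exists_minInfeasible_subset halving solvesOn_child)

namespace Summit.PneNP.PneNP.Theorems.PstarGapAdversaryFn

variable {k n m : ℕ} {I : LocalMap k n m} {y : Fin m → Bool}

/-- **Gap bound with a gap FUNCTION**: every minimal `W`-infeasible set of at most `r` outputs has size at most `g(#W)`. -/
def GapBoundFn (g : ℕ → ℕ) (r : ℕ) (I : LocalMap k n m) (y : Fin m → Bool) : Prop :=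
  ∀ (W : Finset (Finset (Fin n) × Bool)) (J : Finset (Fin m)), J.card ≤ r → MinInfeasible I y W J → J.card ≤ g W.card

/-- The linear gap bound is the gap function `K · _`. -/
theorem gapBoundFn_of_gapBound {K r : ℕ} (h : GapBound K r I y) : GapBoundFn (fun w => K * w) r I y :=
  fun W J hJ hmin => h W J hJ hmin

/-- **RECOVERY.**  Under the gap bound, an `s`-feasible `W` with `g(#W) ≤ s` is `r`-feasible. -/
theorem recovery {g : ℕ → ℕ} {r s : ℕ} (hG : GapBoundFn g r I y) {W : Finset (Finset (Fin n) × Bool)} (hgW : g W.card ≤ s)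
    (hW : RFeasible I y s W) : RFeasible I y r W := by
  intro J hJ
  by_contra hnf
  obtain ⟨J', hJ'J, hmin⟩ := exists_minInfeasible_subset W J hnf
  have h1 : J'.card ≤ g W.card := hG W J' ((card_le_card hJ'J).trans hJ) hmin
  exact hmin.1 (hW J' (h1.trans hgW))

/-- **START.**  If `g 0 = 0` the empty system is `r`-feasible under the gap bound (a nonempty minimal infeasible set would have
size `≤ g 0`).  (For a general `g` this has to be supplied — e.g. by peeling, `PstarGapPeeling.rFeasible_empty`.) -/
theorem rFeasible_of_gapBoundFn {g : ℕ → ℕ} {r : ℕ} (hG : GapBoundFn g r I y) (h0 : g 0 = 0) : RFeasible I y r ∅ := by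
  intro J hJ
  by_contra hnf
  obtain ⟨J', hJ'J, hmin⟩ := exists_minInfeasible_subset (I := I) (y := y) ∅ J hnf
  have h1 := hG ∅ J' ((card_le_card hJ'J).trans hJ) hmin
  rw [card_empty, h0, Nat.le_zero, card_eq_zero] at h1
  subst h1
  exact hmin.1 ⟨fun _ => false, PstarGapLemma.sat_empty _, fun j hj => absurd hj (notMem_empty j)⟩

/-- **MAIN.**  Under the gap bound with monotone `g` and `1 ≤ r`: if `W` is `r`-feasible and `T` solves the problem on the solution
set of `W`, then `⌊r/2⌋ < g(#W + depth T)`. -/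
theorem main {g : ℕ → ℕ} (hg : Monotone g) {r : ℕ} (hG : GapBoundFn g r I y) (hr : 1 ≤ r) :
    ∀ (T : PDT n m) (W : Finset (Finset (Fin n) × Bool)), RFeasible I y r W →
      (∀ z : Fin n → Bool, Sat W z → I.eval z (T.run z) ≠ y (T.run z)) → r / 2 < g (W.card + T.depth) := by
  intro T
  induction T with
  | leaf j =>
    intro W hW hS
    obtain ⟨z, hz, hzj⟩ := hW {j} (by simpa using hr)
    exact absurd (hzj j (mem_singleton_self j)) (hS z hz)
  | node S t₀ t₁ ih₀ ih₁ =>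
    intro W hW hS
    obtain ⟨b, hb⟩ := halving hW S
    by_cases hK : r / 2 < g (W.card + 1)
    · exact lt_of_lt_of_le hK (hg (by simp [PDT.depth]))
    · push Not at hK
      have hcard : (insert (S, b) W).card ≤ W.card + 1 := card_insert_le _ _
      have hRb : RFeasible I y r (insert (S, b) W) := recovery hG ((hg hcard).trans hK) hb
      have hSb := solvesOn_child hS b
      cases b
      · have h0 := ih₀ _ hRb (by simpa using hSb)
        refine lt_of_lt_of_le h0 (hg ?_)
        have : t₀.depth ≤ max t₀.depth t₁.depth := le_max_left _ _
        simp only [PDT.depth]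
        omega
      · have h1 := ih₁ _ hRb (by simpa using hSb)
        refine lt_of_lt_of_le h1 (hg ?_)
        have : t₁.depth ≤ max t₀.depth t₁.depth := le_max_right _ _
        simp only [PDT.depth]
        omega

/-- **T24.7′ — the adversary for a monotone gap function**, given `r`-feasibility of the empty system (supplied by peeling on
expanding pure instances, `PstarGapPeeling.rFeasible_empty`, or by `g 0 = 0`): every parity decision tree solving the falsified-output
search problem has depth `d` with `r ≤ 2·g(d) + 1`. -/
theorem gapAdversaryFn_of_rFeasible {g : ℕ → ℕ} (hg : Monotone g) {r : ℕ} (hG : GapBoundFn g r I y) (h0 : RFeasible I y r ∅)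
    {T : PDT n m} (hT : T.Solves I y) : r ≤ 2 * g T.depth + 1 := by
  rcases Nat.eq_zero_or_pos r with hr0 | hr
  · omega
  · have h := main hg hG hr T ∅ h0 (solvesOn_empty hT)
    simp only [card_empty, zero_add] at h
    omega

/-- **T24.7′ with `g 0 = 0`** (the shape of every gap function that vanishes on the empty system, e.g. `K·w`, `K·w^c`). -/
theorem gapAdversaryFn {g : ℕ → ℕ} (hg : Monotone g) (hg0 : g 0 = 0) {r : ℕ} (hG : GapBoundFn g r I y) {T : PDT n m}
    (hT : T.Solves I y) : r ≤ 2 * g T.depth + 1 :=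
  gapAdversaryFn_of_rFeasible hg hG (rFeasible_of_gapBoundFn hG hg0) hT

/-- Sanity: the linear case gives back T24.7's bound. -/
theorem gapAdversary_linear {K r : ℕ} (hG : GapBound K r I y) {T : PDT n m} (hT : T.Solves I y) : r ≤ 2 * (K * T.depth) + 1 :=
  gapAdversaryFn (g := fun w => K * w) (fun _ _ h => Nat.mul_le_mul_left K h) (Nat.mul_zero K) (gapBoundFn_of_gapBound hG) hT

end Summit.PneNP.PneNP.Theorems.PstarGapAdversaryFn
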